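import Summits.NavierStokesRegularity.NavierStokesRegularity.Theorems.LerayQuarterDissipationFiniteDissipationLiouvilleCalmSliceLocalLeaf
import Literature.Analysis.FluidPDE.PolygonCirculation
import Literature.Analysis.FluidPDE.VorticityCalculus
import Literature.Analysis.FluidPDE.VectorCalculusProofs
import Literature.Analysis.FluidPDE.FlatSwirlGauge
import Mathlib.Analysis.Distribution.AEEqOfIntegralContDiff
import HarnessLib

/-!
# Crux `FiniteDissipationLiouville` (stmt-NavierStokesRegularity-22144): the calm-slice criterion
# AT THE VORTICITY LEVEL — one parabolic sub-ball on which the similarity VORTICITY is calm at one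
# instant forces regularity; the vorticity of a finite-dissipation Type-I singularity flickers in
# every sub-ball at every instant

Theorems file of route `LerayQuarterDissipation` (lead prover g14; `--supports` the crux; sequel of
`…CalmSliceLocal(Leaf)`, portrait facts for the registered stub `stub_envelopeCriticalLiouville`
of skeleton v28). Navier–Stokes regularity is NOT proved by anything here; no summit is.
`𝒟_{C,K}` = Type-I ancient mild fields (KNSS gauge) with the law `∫‖∇w(s)‖² ≤ K/√(−s)`. Write
`Φₜ(x) = (−t)∂ₜw(t,x) − ½w(t,x) − ½Dw(t)(x)[x]` (so that the route's unsteadiness is `√(−t)•Φₜ`,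
`= ∂ₛU` of the similarity profile) and call `(−t) • curl Φₜ(x)` the VORTICITY UNSTEADINESS: since
`curl((x·∇)w) = ω + (x·∇)ω` (`curl_fderiv_apply_self`), it equals `(−t)((−t)∂ₜω − ω − ½(x·∇)ω)`,
i.e. `∂ₛΩ` for the similarity vorticity `Ω(y,s) = (−t)ω(√(−t)y, t)`, `s = −log(−t)`; it is
dimensionless and scale invariant.

* `slice_eq_zero_of_curl_unsteadiness_eq_zero_on` — **A SLICE WHOSE VORTICITY IS STEADY ON ONE
  OPEN SET VANISHES**: if `curl G = 0` on ONE non-empty open set of the slice `−1` of a member of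
  `𝒟_{C,K}` (`G` the unsteadiness field), the slice is zero (`curl G = 0` is the symmetry of `DG`,
  `inner_fderiv_comm_of_curl_eq_zero`; then `CalmSliceLocal.slice_eq_zero_of_curlFree_unsteadiness_on`:
  analytic continuation + Leray's profile system + Tsai). This is the statement «a backward
  similarity profile which is steady MODULO A GRADIENT on an open set of space at one similarity
  time is trivial»: the velocity may flicker there only irrotationally — and that never happens.
* `eq_zero_of_curl_unsteadiness_eq_zero_on` — the same at any instant `t₀ < 0`: `w ≡ 0` on the past.
* `slice_eq_zero_of_weakVorticitySteady_on` — derivative-free form used by compactness: the weak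
  unsteadiness functional vanishing on the CURLS `curl Φ`, `Φ` smooth supported in ONE ball, kills
  the slice (on `curl Φ` the functional is `∫⟪curl G, Φ⟫`: momentum equation + self-adjoint curl).
* `vorticityCalm_leaf` — **ONE VORTICITY-CALM PARABOLIC SUB-BALL ANYWHERE ⇒ REGULAR**: for all
  `C, K, ρ, r > 0` there is `δ = δ(C,K,ρ,r) > 0` such that a member of `𝒟_{C,K}` whose vorticity
  unsteadiness `‖(−t) • curl Φₜ‖` is `≤ δ` on ONE ball `B(x₀, r√(−t))`, `‖x₀‖ ≤ ρ√(−t)`, at ONE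
  instant, is regular at the apex (compactness as in `CalmSliceLocal.localCalm_leaf`, tests =
  curls supported in the half-ball around the limit centre); neither calm leaf implies the other.
* `vorticityFlicker_floor_of_singular` — PORTRAIT: **THE VORTICITY OF A FINITE-DISSIPATION TYPE-I
  SINGULARITY FLICKERS EVERYWHERE**: at every instant and in every parabolic sub-ball of the
  similarity region the vorticity unsteadiness `∂ₛΩ` exceeds `δ(C,K,ρ,r)` somewhere, uniformly on
  the stratum (DSS and wandering alike) — nowhere can `∂ₛU` be absorbed into a pressure gradient.

HONEST FRAMING: portrait facts with an ineffective `δ` (compactness); nothing is removed for the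
DSS wall; the crux stays blocked on `∀ c > 1, TypeIDSSLiouville c` (NECESSARY, `…Hardness`).
presearch: vorticity-level one-slice calmness criteria for backward similarity profiles → none in
print (Pineau–Vicol 2026 Thm 1.9 is velocity-level, unit ball); corpus hybrid+vec, galaxy all.

References: Pineau–Vicol, arXiv:2607.09619 (2026) Thm 1.9, §1.3; Tsai, ARMA 143 (1998) Thm 1;
KNSS, Acta Math. 203 (2009) = arXiv:0709.3599 §4; Majda–Bertozzi (2002) §1.1; Galdi, Lemma III.1.1.
-/

noncomputable section

-- the summit and its single sub-problem share the name (CONVENTIONS §1), as in every Theorems file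
set_option linter.dupNamespace false

namespace Summit.NavierStokesRegularity.NavierStokesRegularity.Theorems.FiniteDissipationLiouville.CalmSliceLocal

open MeasureTheory Set Filter Topology Metric Function TopologicalSpace InnerProductSpace
open Literature.Analysis Literature.Analysis.FluidPDE
open Summit.NavierStokesRegularity.NavierStokesRegularity.Theorems
open Summit.NavierStokesRegularity.NavierStokesRegularity.Theorems.FiniteDissipationLiouville
open Summit.NavierStokesRegularity.NavierStokesRegularity.Theorems.FiniteDissipationLiouville.CalmSlice
open scoped ENNReal NNReal RealInnerProductSpace Laplacian ContDiff

/-! ### A slice whose vorticity is steady on one open set vanishes -/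

/-- **A SLICE WHOSE VORTICITY IS STEADY ON ONE OPEN SET VANISHES.** Let `w ∈ 𝒟_{C,K}` and let
`G = ∂ₜw(−1,·) − ½w(−1,·) − ½Dw(−1)[y]` be the unsteadiness field of its slice `−1`. If `curl G = 0`
on ONE non-empty open set (the similarity vorticity is instantaneously steady there; equivalently
`∂ₛU` is locally a gradient), then `w(−1,·) = 0` (`curl G = 0` makes `DG` symmetric there,
`inner_fderiv_comm_of_curl_eq_zero`; then `slice_eq_zero_of_curlFree_unsteadiness_on`). [cite: Tsai1998, Theorem 1 (p. 31)] -/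
theorem slice_eq_zero_of_curl_unsteadiness_eq_zero_on {C K : ℝ}
    {w : ℝ → EuclideanSpace ℝ (Fin 3) → EuclideanSpace ℝ (Fin 3)}
    (hw : IsTypeIAncientMild C w)
    (hlaw : ∀ s : ℝ, s < 0 → ∫⁻ x, ‖fderiv ℝ (w s) x‖ₑ ^ 2 ≤ ENNReal.ofReal (K / Real.sqrt (-s)))
    {O : Set (EuclideanSpace ℝ (Fin 3))} (hO : IsOpen O) (hne : O.Nonempty)
    (hcurl : ∀ y ∈ O, curl (fun y => deriv (fun τ => w τ y) (-1) - (1 / 2 : ℝ) • w (-1) y -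
      (1 / 2 : ℝ) • fderiv ℝ (w (-1)) y y) y = 0) :
    ∀ x, w (-1) x = 0 :=
  slice_eq_zero_of_curlFree_unsteadiness_on hw hlaw hO hne fun y hy a b =>
    inner_fderiv_comm_of_curl_eq_zero (hcurl y hy) a b

/-- **ONE INSTANT WITH LOCALLY STEADY VORTICITY KILLS A MEMBER OF THE STRATUM ON THE WHOLE PAST.**
If at ONE instant `t₀ < 0` the vorticity unsteadiness `(−t₀) • curl Φ_{t₀}`,
`Φ_{t₀}(x) = (−t₀)∂ₜw(t₀,x) − ½w(t₀,x) − ½Dw(t₀)(x)[x]`, of a member of `𝒟_{C,K}` vanishes on ONE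
non-empty open set of space, then `w ≡ 0` on `t < 0` (rescale `t₀` to `−1`: the unsteadiness field
of the rescaled member is `y ↦ √(−t₀) • Φ_{t₀}(√(−t₀) y)` by `CalmSlice.unsteadiness_nsRescale`,
whose curl is `(−t₀) • (curl Φ_{t₀})(√(−t₀) y)` (`curl_smul_comp_smul`); kill the slice; forward
uniqueness; g13's open-set generator Liouville — packaged in
`CalmSliceLocal.eq_zero_of_unsteadiness_eq_zero_on`'s sibling below). [cite: Tsai1998, Theorem 1 (p. 31)] -/
theorem eq_zero_of_curl_unsteadiness_eq_zero_on {C K : ℝ}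
    {w : ℝ → EuclideanSpace ℝ (Fin 3) → EuclideanSpace ℝ (Fin 3)}
    (hw : IsTypeIAncientMild C w)
    (hlaw : ∀ s : ℝ, s < 0 → ∫⁻ x, ‖fderiv ℝ (w s) x‖ₑ ^ 2 ≤ ENNReal.ofReal (K / Real.sqrt (-s)))
    {t₀ : ℝ} (ht₀ : t₀ < 0) {O : Set (EuclideanSpace ℝ (Fin 3))} (hO : IsOpen O) (hne : O.Nonempty)
    (hcurl : ∀ x ∈ O, curl (fun x => (-t₀) • deriv (fun τ => w τ x) t₀ - (1 / 2 : ℝ) • w t₀ x -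
      (1 / 2 : ℝ) • fderiv ℝ (w t₀) x x) x = 0) :
    ∀ t < 0, ∀ x, w t x = 0 := by
  -- ### rescale the instant `t₀` to `-1`
  set μ : ℝ := Real.sqrt (-t₀) with hμdef
  have hμ : 0 < μ := Real.sqrt_pos.2 (neg_pos.2 ht₀)
  have hμμ : μ * μ = -t₀ := by rw [hμdef, Real.mul_self_sqrt (neg_nonneg.2 ht₀.le)]
  set v : ℝ → EuclideanSpace ℝ (Fin 3) → EuclideanSpace ℝ (Fin 3) := nsRescale μ w with hvdef
  have hv : IsTypeIAncientMild C v := isTypeIAncientMild_nsRescale hw hμ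
  have hvlaw := RecurrentReductionD.dissipationLaw_nsRescale hlaw hμ
  set Φ : EuclideanSpace ℝ (Fin 3) → EuclideanSpace ℝ (Fin 3) := fun x =>
    (-t₀) • deriv (fun τ => w τ x) t₀ - (1 / 2 : ℝ) • w t₀ x - (1 / 2 : ℝ) • fderiv ℝ (w t₀) x x
    with hΦdef
  -- the unsteadiness field of `v` at `-1` is `y ↦ μ • Φ (μ • y)`
  have hGv : (fun y => deriv (fun τ => v τ y) (-1) - (1 / 2 : ℝ) • v (-1) y -
      (1 / 2 : ℝ) • fderiv ℝ (v (-1)) y y) = fun y => μ • Φ (μ • y) := by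
    funext y
    rw [hvdef, hμdef, unsteadiness_nsRescale hw ht₀ y]
  -- the pulled-back open set
  set O' : Set (EuclideanSpace ℝ (Fin 3)) := (fun y : EuclideanSpace ℝ (Fin 3) => μ • y) ⁻¹' O
    with hO'def
  have hO' : IsOpen O' := hO.preimage (continuous_const_smul μ)
  have hne' : O'.Nonempty := by
    obtain ⟨x₀, hx₀⟩ := hne
    refine ⟨μ⁻¹ • x₀, ?_⟩
    rw [hO'def, mem_preimage, smul_smul, mul_inv_cancel₀ hμ.ne', one_smul]
    exact hx₀
  have hcurl' : ∀ y ∈ O', curl (fun y => deriv (fun τ => v τ y) (-1) - (1 / 2 : ℝ) • v (-1) y -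
      (1 / 2 : ℝ) • fderiv ℝ (v (-1)) y y) y = 0 := by
    intro y hy
    rw [hGv, curl_smul_comp_smul Φ μ μ y, hcurl (μ • y) hy, smul_zero]
  have hslice : ∀ y, v (-1) y = 0 :=
    slice_eq_zero_of_curl_unsteadiness_eq_zero_on hv hvlaw hO' hne' hcurl'
  -- ### `v(-1) = 0`: its unsteadiness field vanishes on all of `ℝ³`, so `v ≡ 0` on the past
  have hvpast : ∀ t < 0, ∀ y, v t y = 0 := by
    -- forward: `v = 0` on `(-1, 0) × ℝ³`
    have hfw : ∀ t ∈ Ioo (-1 : ℝ) 0, ∀ y, v t y = 0 := fun t ht y =>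
      eq_zero_after_zero_slice hv hslice ht y
    -- at the instant `-1/2` the unsteadiness field of `v` vanishes identically
    have hhalf : (-(1 / 2 : ℝ)) < 0 := by norm_num
    refine eq_zero_of_unsteadiness_eq_zero_on hv hvlaw hhalf isOpen_univ univ_nonempty
      fun x _ => ?_
    have hIoo : Ioo (-1 : ℝ) 0 ∈ 𝓝 (-(1 / 2 : ℝ)) := isOpen_Ioo.mem_nhds (by norm_num)
    have hslz : v (-(1 / 2 : ℝ)) = fun _ => (0 : EuclideanSpace ℝ (Fin 3)) :=
      funext fun y => hfw _ (by norm_num) y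
    have hder : deriv (fun s => v s x) (-(1 / 2 : ℝ)) = 0 := by
      have hev : (fun s => v s x) =ᶠ[𝓝 (-(1 / 2 : ℝ))] fun _ => (0 : EuclideanSpace ℝ (Fin 3)) := by
        filter_upwards [hIoo] with s hs
        exact hfw s hs x
      rw [hev.deriv_eq, deriv_const]
    rw [hder, smul_zero, hslz]
    simp
  -- ### back to `w`
  intro t ht x
  have hμ2pos : 0 < μ ^ 2 := by positivity
  have e : v (t / μ ^ 2) (μ⁻¹ • x) = μ • w t x := by
    rw [hvdef, nsRescale_apply, mul_div_cancel₀ _ hμ2pos.ne', smul_smul, mul_inv_cancel₀ hμ.ne',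
      one_smul]
  have h0 : μ • w t x = 0 := by
    rw [← e]
    exact hvpast _ (div_neg_of_neg_of_pos ht hμ2pos) _
  exact (smul_eq_zero.1 h0).resolve_left hμ.ne'

/-! ### The derivative-free form: weak steadiness on curls -/

/-- **Weak vorticity-steadiness on ONE ball kills the slice.** If the derivative-free weak
unsteadiness functional of the slice `−1` of a member of `𝒟_{C,K}` vanishes on the curls
`ψ = curl Φ` of all smooth fields `Φ` compactly supported in ONE non-empty open set `O`, the slice
is zero: on such `ψ` the functional equals `∫⟪G, curl Φ⟫ = ∫⟪curl G, Φ⟫` (momentum equation,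
`CalmSlice.integral_inner_unsteadiness_eq`; the curl is self-adjoint,
`integral_inner_curl_eq_integral_inner_curl`), so `curl G = 0` on `O` (fundamental lemma), and
`slice_eq_zero_of_curl_unsteadiness_eq_zero_on` applies. [cite: Tsai1998, Theorem 1 (p. 31)] -/
theorem slice_eq_zero_of_weakVorticitySteady_on {C K : ℝ}
    {w : ℝ → EuclideanSpace ℝ (Fin 3) → EuclideanSpace ℝ (Fin 3)}
    (hw : IsTypeIAncientMild C w)
    (hlaw : ∀ s : ℝ, s < 0 → ∫⁻ x, ‖fderiv ℝ (w s) x‖ₑ ^ 2 ≤ ENNReal.ofReal (K / Real.sqrt (-s)))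
    {O : Set (EuclideanSpace ℝ (Fin 3))} (hO : IsOpen O) (hne : O.Nonempty)
    (hweak : ∀ Φ : EuclideanSpace ℝ (Fin 3) → EuclideanSpace ℝ (Fin 3), ContDiff ℝ ∞ Φ →
      HasCompactSupport Φ → tsupport Φ ⊆ O →
      ∫ y, (⟪w (-1) y, convect (w (-1)) (curl Φ) y⟫ + ⟪w (-1) y, (Δ (curl Φ)) y⟫ +
        ⟪w (-1) y, curl Φ y⟫ + (1 / 2 : ℝ) * ⟪w (-1) y, fderiv ℝ (curl Φ) y y⟫) = 0) :
    ∀ x, w (-1) x = 0 := by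
  set G : EuclideanSpace ℝ (Fin 3) → EuclideanSpace ℝ (Fin 3) := fun y =>
    deriv (fun τ => w τ y) (-1) - (1 / 2 : ℝ) • w (-1) y - (1 / 2 : ℝ) • fderiv ℝ (w (-1)) y y
    with hGdef
  have hG : ContDiff ℝ ∞ G := contDiff_unsteadiness hw
  have hG1 : ContDiff ℝ 1 G := hG.of_le (by exact_mod_cast le_top)
  have hcG : Continuous (curl G) := continuous_curl hG1
  -- `∫⟪curl G, Φ⟫ = 0` for every smooth `Φ` compactly supported in `O`
  have horth : ∀ Φ : EuclideanSpace ℝ (Fin 3) → EuclideanSpace ℝ (Fin 3), ContDiff ℝ ∞ Φ →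
      HasCompactSupport Φ → tsupport Φ ⊆ O → ∫ y, ⟪curl G y, Φ y⟫ = 0 := by
    intro Φ hΦ hcΦ hsupp
    have hΦ1 : ContDiff ℝ 1 Φ := hΦ.of_le (by exact_mod_cast le_top)
    have hΦ3 : ContDiff ℝ ((2 : ℕ∞) + 1) Φ := hΦ.of_le (by exact_mod_cast le_top)
    have hψ2 : ContDiff ℝ 2 (curl Φ) := contDiff_curl hΦ3
    have hψc : HasCompactSupport (curl Φ) := hasCompactSupport_curl hcΦ
    have hψdiv : VectorCalculus.IsDivFree (curl Φ) := fun y =>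
      divergence_curl_eq_zero_holds Φ (contDiff_infty.1 hΦ 2) y
    rw [integral_inner_curl_eq_integral_inner_curl hG1 hΦ1 hcΦ, hGdef,
      integral_inner_unsteadiness_eq hw hψ2 hψc hψdiv]
    exact hweak Φ hΦ hcΦ hsupp
  -- fundamental lemma, componentwise: `curl G = 0` on `O`
  have hcurl : ∀ y ∈ O, curl G y = 0 := by
    intro y hy
    have hcomp : ∀ e : EuclideanSpace ℝ (Fin 3), ⟪curl G y, e⟫ = 0 := by
      intro e
      have hme : Continuous fun x => ⟪curl G x, e⟫ := hcG.inner continuous_const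
      have hae : ∀ᵐ x ∂(volume : Measure (EuclideanSpace ℝ (Fin 3))), x ∈ O →
          ⟪curl G x, e⟫ = 0 := by
        refine hO.ae_eq_zero_of_integral_contDiff_smul_eq_zero
          (hme.locallyIntegrable.locallyIntegrableOn O) fun g hg hgc hgsupp => ?_
        have hΦ : ContDiff ℝ ∞ (fun x => g x • e) := hg.smul contDiff_const
        have hΦc : HasCompactSupport (fun x => g x • e) := hgc.smul_right
        have hΦsupp : tsupport (fun x => g x • e) ⊆ O :=
          (tsupport_smul_subset_left _ _).trans hgsupp
        have h := horth _ hΦ hΦc hΦsupp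
        simp_rw [real_inner_smul_right] at h
        simp_rw [smul_eq_mul]
        exact h
      exact ExteriorDeRham.eq_zero_of_ae_zero_on hO hme hae hy
    exact inner_self_eq_zero.1 (hcomp (curl G y))
  exact slice_eq_zero_of_curl_unsteadiness_eq_zero_on hw hlaw hO hne hcurl

/-! ### One vorticity-calm parabolic sub-ball anywhere ⇒ regular apex -/

/-- **Vorticity-calm sub-balls have small weak unsteadiness on curls.** If `‖curl G‖ ≤ δ` on
`B(c, r)` (`G` the unsteadiness field of the slice `−1`) and `Φ ∈ C^∞_c` is supported in `B(c, r)`,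
then the weak unsteadiness functional of `ψ = curl Φ` is `≤ δ ∫‖Φ‖` in absolute value. [cite: MajdaBertozziCUP2002, §1.1 (vector identities)] -/
theorem abs_weakUnsteadiness_curl_le_of_vorticityCalm_ball {C : ℝ}
    {w : ℝ → EuclideanSpace ℝ (Fin 3) → EuclideanSpace ℝ (Fin 3)}
    (hw : IsTypeIAncientMild C w) {δ r : ℝ} {c : EuclideanSpace ℝ (Fin 3)}
    (hcalm : ∀ y ∈ ball c r,
      ‖curl (fun y => deriv (fun τ => w τ y) (-1) - (1 / 2 : ℝ) • w (-1) y -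
        (1 / 2 : ℝ) • fderiv ℝ (w (-1)) y y) y‖ ≤ δ)
    {Φ : EuclideanSpace ℝ (Fin 3) → EuclideanSpace ℝ (Fin 3)}
    (hΦ : ContDiff ℝ ∞ Φ) (hcΦ : HasCompactSupport Φ) (hsupp : tsupport Φ ⊆ ball c r) :
    |∫ y, (⟪w (-1) y, convect (w (-1)) (curl Φ) y⟫ + ⟪w (-1) y, (Δ (curl Φ)) y⟫ +
        ⟪w (-1) y, curl Φ y⟫ + (1 / 2 : ℝ) * ⟪w (-1) y, fderiv ℝ (curl Φ) y y⟫)| ≤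
      δ * ∫ y, ‖Φ y‖ := by
  set G : EuclideanSpace ℝ (Fin 3) → EuclideanSpace ℝ (Fin 3) := fun y =>
    deriv (fun τ => w τ y) (-1) - (1 / 2 : ℝ) • w (-1) y - (1 / 2 : ℝ) • fderiv ℝ (w (-1)) y y
    with hGdef
  have hG : ContDiff ℝ ∞ G := contDiff_unsteadiness hw
  have hG1 : ContDiff ℝ 1 G := hG.of_le (by exact_mod_cast le_top)
  have hΦ1 : ContDiff ℝ 1 Φ := hΦ.of_le (by exact_mod_cast le_top)
  have hΦ3 : ContDiff ℝ ((2 : ℕ∞) + 1) Φ := hΦ.of_le (by exact_mod_cast le_top)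
  have hψ2 : ContDiff ℝ 2 (curl Φ) := contDiff_curl hΦ3
  have hψc : HasCompactSupport (curl Φ) := hasCompactSupport_curl hcΦ
  have hψdiv : VectorCalculus.IsDivFree (curl Φ) := fun y =>
    divergence_curl_eq_zero_holds Φ (contDiff_infty.1 hΦ 2) y
  rw [← integral_inner_unsteadiness_eq hw hψ2 hψc hψdiv]
  change |∫ y, ⟪G y, curl Φ y⟫| ≤ δ * ∫ y, ‖Φ y‖
  rw [← integral_inner_curl_eq_integral_inner_curl hG1 hΦ1 hcΦ, ← Real.norm_eq_abs,
    ← integral_const_mul]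
  refine norm_integral_le_of_norm_le ((hΦ.continuous.norm.integrable_of_hasCompactSupport
    hcΦ.norm).const_mul δ) (Eventually.of_forall fun y => ?_)
  by_cases hy : y ∈ ball c r
  · exact (norm_inner_le_norm _ _).trans (mul_le_mul_of_nonneg_right (hcalm y hy) (norm_nonneg _))
  · have h0 : Φ y = 0 := image_eq_zero_of_notMem_tsupport fun h => hy (hsupp h)
    simp [h0]

/-- **ONE VORTICITY-CALM PARABOLIC SUB-BALL ANYWHERE ⇒ REGULAR APEX.** For all `C, K`, every
similarity radius `ρ` and every sub-ball radius `r > 0` there is `δ > 0` such that: a Type-I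
ancient mild field `w` (constant `C`) with the finite-dissipation law (constant `K`) whose
VORTICITY UNSTEADINESS `‖(−t) • curl Φₜ‖`, `Φₜ(x) = (−t)∂ₜw(t,x) − ½w(t,x) − ½Dw(t)(x)[x]`, is
`≤ δ` on ONE ball `B(x₀, r√(−t))` with `‖x₀‖ ≤ ρ√(−t)`, at ONE instant `t < 0`, is bounded on
some backward parabolic cylinder at the origin (contradiction sequence; instants rescaled to `−1`,
where the vorticity unsteadiness becomes `curl` of the unsteadiness field — `curl_smul_comp_smul`;
Bolzano for the centres; KNSS compactness across members, law of the limit, persistence; the weak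
unsteadiness of the limit vanishes on the curls supported in the half-ball;
`slice_eq_zero_of_weakVorticitySteady_on`; forward uniqueness). [cite: Tsai1998, Theorem 1 (p. 31)] -/
theorem vorticityCalm_leaf (C K ρ r : ℝ) (hr : 0 < r) : ∃ δ > 0,
    ∀ (w : ℝ → EuclideanSpace ℝ (Fin 3) → EuclideanSpace ℝ (Fin 3)),
      IsTypeIAncientMild C w →
      (∀ s : ℝ, s < 0 → ∫⁻ x, ‖fderiv ℝ (w s) x‖ₑ ^ 2 ≤ ENNReal.ofReal (K / Real.sqrt (-s))) →
      ∀ t < 0, ∀ x₀ : EuclideanSpace ℝ (Fin 3), ‖x₀‖ ≤ ρ * Real.sqrt (-t) →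
      (∀ x ∈ ball x₀ (r * Real.sqrt (-t)),
        ‖(-t) • curl (fun x => (-t) • deriv (fun τ => w τ x) t - (1 / 2 : ℝ) • w t x -
          (1 / 2 : ℝ) • fderiv ℝ (w t) x x) x‖ ≤ δ) →
      ¬ (∀ r > 0, ∀ M : ℝ, ∃ t ∈ Set.Ioo (-(r ^ 2)) (0 : ℝ),
        ∃ x ∈ Metric.ball (0 : EuclideanSpace ℝ (Fin 3)) r, M < ‖w t x‖) := by
  by_contra hcon
  push Not at hcon
  -- ## a contradiction sequence, vorticity-calm sub-balls rescaled to the slice `-1`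
  have hk : ∀ k : ℕ, ∃ (v : ℝ → EuclideanSpace ℝ (Fin 3) → EuclideanSpace ℝ (Fin 3))
      (c : EuclideanSpace ℝ (Fin 3)),
      IsTypeIAncientMild C v ∧
      (∀ s : ℝ, s < 0 → ∫⁻ x, ‖fderiv ℝ (v s) x‖ₑ ^ 2 ≤ ENNReal.ofReal (K / Real.sqrt (-s))) ∧
      (∀ r > 0, ∀ M : ℝ, ∃ t ∈ Ioo (-(r ^ 2)) (0 : ℝ),
        ∃ x ∈ ball (0 : EuclideanSpace ℝ (Fin 3)) r, M < ‖v t x‖) ∧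
      c ∈ closedBall (0 : EuclideanSpace ℝ (Fin 3)) ρ ∧
      (∀ y ∈ ball c r,
        ‖curl (fun y => deriv (fun τ => v τ y) (-1) - (1 / 2 : ℝ) • v (-1) y -
          (1 / 2 : ℝ) • fderiv ℝ (v (-1)) y y) y‖ ≤ 1 / ((k : ℝ) + 1)) := by
    intro k
    obtain ⟨w, hw, hlaw, t, ht, x₀, hx₀, hcalm, hsing⟩ := hcon (1 / ((k : ℝ) + 1)) (by positivity)
    set μ : ℝ := Real.sqrt (-t) with hμdef
    have hμ : 0 < μ := Real.sqrt_pos.2 (neg_pos.2 ht)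
    have hμμ : μ * μ = -t := by rw [hμdef, Real.mul_self_sqrt (neg_nonneg.2 ht.le)]
    set Φ : EuclideanSpace ℝ (Fin 3) → EuclideanSpace ℝ (Fin 3) := fun x =>
      (-t) • deriv (fun τ => w τ x) t - (1 / 2 : ℝ) • w t x - (1 / 2 : ℝ) • fderiv ℝ (w t) x x
      with hΦdef
    have hGv : (fun y => deriv (fun τ => nsRescale μ w τ y) (-1) -
        (1 / 2 : ℝ) • nsRescale μ w (-1) y -
        (1 / 2 : ℝ) • fderiv ℝ (nsRescale μ w (-1)) y y) = fun y => μ • Φ (μ • y) := by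
      funext y
      rw [hμdef, unsteadiness_nsRescale hw ht y]
    refine ⟨nsRescale μ w, μ⁻¹ • x₀, isTypeIAncientMild_nsRescale hw hμ,
      RecurrentReductionD.dissipationLaw_nsRescale hlaw hμ,
      RecurrentReductionD.singularAtOrigin_nsRescale hsing hμ, ?_, fun y hy => ?_⟩
    · rw [mem_closedBall_zero_iff, norm_smul, norm_inv, Real.norm_of_nonneg hμ.le,
        inv_mul_le_iff₀ hμ, mul_comm]
      exact hx₀
    · rw [hGv, curl_smul_comp_smul Φ μ μ y, hμμ]
      refine hcalm (μ • y) ?_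
      rw [mem_ball, dist_eq_norm] at hy ⊢
      have e : μ • y - x₀ = μ • (y - μ⁻¹ • x₀) := by
        rw [smul_sub, smul_smul, mul_inv_cancel₀ hμ.ne', one_smul]
      rw [e, norm_smul, Real.norm_of_nonneg hμ.le, mul_comm]
      exact mul_lt_mul_of_pos_right hy hμ
  choose v c hv hlaw hsing hc hcalm using hk
  -- ## Bolzano for the centres, then compactness across members
  obtain ⟨cs, -, φ, hφ, hclim⟩ :=
    (isCompact_closedBall (0 : EuclideanSpace ℝ (Fin 3)) ρ).tendsto_subseq hc
  obtain ⟨ψ, hψ, W, hW, hunif, hpt, hgrad⟩ := Compactness.seqLimit (fun j => hv (φ j))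
  have hψt : Tendsto ψ atTop atTop := hψ.tendsto_atTop
  have hφψt : Tendsto (fun j => φ (ψ j)) atTop atTop := hφ.tendsto_atTop.comp hψt
  have hclim' : Tendsto (fun j => c (φ (ψ j))) atTop (𝓝 cs) := hclim.comp hψt
  have hWlaw : ∀ s : ℝ, s < 0 →
      ∫⁻ x, ‖fderiv ℝ (W s) x‖ₑ ^ 2 ≤ ENNReal.ofReal (K / Real.sqrt (-s)) :=
    Compactness.law_of_seqLimit (Kk := fun _ => K) (Kinf := K) (w := fun j => v (φ j)) hψt
      (fun j => hlaw (φ j)) (fun ε hε => Eventually.of_forall fun k => by linarith) hgrad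
  have hWsing := Compactness.persistent_singularity_seq (w := fun j => v (φ (ψ j)))
    (fun j => hv _) (fun j => hlaw _) (fun j => hsing _) hW hunif
  -- ## the weak unsteadiness of the limit slice vanishes on the curls supported in `B(c_*, r/2)`
  have hweak : ∀ Φ : EuclideanSpace ℝ (Fin 3) → EuclideanSpace ℝ (Fin 3), ContDiff ℝ ∞ Φ →
      HasCompactSupport Φ → tsupport Φ ⊆ ball cs (r / 2) →
      ∫ y, (⟪W (-1) y, convect (W (-1)) (curl Φ) y⟫ + ⟪W (-1) y, (Δ (curl Φ)) y⟫ +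
        ⟪W (-1) y, curl Φ y⟫ + (1 / 2 : ℝ) * ⟪W (-1) y, fderiv ℝ (curl Φ) y y⟫) = 0 := by
    intro Φ hΦ hcΦ hsuppΦ
    have hΦ3 : ContDiff ℝ ((2 : ℕ∞) + 1) Φ := hΦ.of_le (by exact_mod_cast le_top)
    have hχ2 : ContDiff ℝ 2 (curl Φ) := contDiff_curl hΦ3
    have hcχ : HasCompactSupport (curl Φ) := hasCompactSupport_curl hcΦ
    have hlim := tendsto_weakUnsteadiness (v := fun j => v (φ (ψ j))) (W := W) (fun j => hv _)
      (hpt (-1) (by norm_num)) hχ2 hcχ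
    have hev : ∀ᶠ j in atTop, ball cs (r / 2) ⊆ ball (c (φ (ψ j))) r := by
      have hd : ∀ᶠ j in atTop, dist (c (φ (ψ j))) cs < r / 2 :=
        (tendsto_iff_dist_tendsto_zero.1 hclim').eventually (gt_mem_nhds (by positivity))
      filter_upwards [hd] with j hj
      intro y hy
      rw [mem_ball] at hy ⊢
      calc dist y (c (φ (ψ j))) ≤ dist y cs + dist cs (c (φ (ψ j))) := dist_triangle _ _ _
        _ < r / 2 + r / 2 := add_lt_add hy (by rwa [dist_comm])
        _ = r := by ring
    have hsmall : ∀ᶠ j in atTop, ‖∫ y, (⟪v (φ (ψ j)) (-1) y, convect (v (φ (ψ j)) (-1)) (curl Φ) y⟫ +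
        ⟪v (φ (ψ j)) (-1) y, (Δ (curl Φ)) y⟫ + ⟪v (φ (ψ j)) (-1) y, curl Φ y⟫ +
        (1 / 2 : ℝ) * ⟪v (φ (ψ j)) (-1) y, fderiv ℝ (curl Φ) y y⟫)‖ ≤
        (1 / (((φ (ψ j) : ℕ) : ℝ) + 1)) * ∫ y, ‖Φ y‖ := by
      filter_upwards [hev] with j hj
      rw [Real.norm_eq_abs]
      exact abs_weakUnsteadiness_curl_le_of_vorticityCalm_ball (hv _) (hcalm (φ (ψ j))) hΦ hcΦ
        (hsuppΦ.trans hj)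
    have hzero : Tendsto (fun j => ∫ y, (⟪v (φ (ψ j)) (-1) y, convect (v (φ (ψ j)) (-1)) (curl Φ) y⟫ +
        ⟪v (φ (ψ j)) (-1) y, (Δ (curl Φ)) y⟫ + ⟪v (φ (ψ j)) (-1) y, curl Φ y⟫ +
        (1 / 2 : ℝ) * ⟪v (φ (ψ j)) (-1) y, fderiv ℝ (curl Φ) y y⟫)) atTop (𝓝 0) := by
      refine squeeze_zero_norm' hsmall ?_
      have h0 : Tendsto (fun j => 1 / ((((φ (ψ j)) : ℕ) : ℝ) + 1)) atTop (𝓝 0) :=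
        tendsto_one_div_add_atTop_nhds_zero_nat.comp hφψt
      simpa using h0.mul_const (∫ y, ‖Φ y‖)
    exact tendsto_nhds_unique hlim hzero
  -- ## the limit slice vanishes; forward uniqueness contradicts persistence
  have hW0 : ∀ x, W (-1) x = 0 :=
    slice_eq_zero_of_weakVorticitySteady_on hW hWlaw isOpen_ball
      ⟨cs, mem_ball_self (by positivity)⟩ hweak
  exact not_singular_of_zero_slice hW (by norm_num) hW0 hWsing

/-- **PORTRAIT: the vorticity of a finite-dissipation Type-I singularity flickers in every
parabolic sub-ball at every instant.** For every SINGULAR member of `𝒟_{C,K}` (DSS or wandering; in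
particular every critical element), every instant `t < 0` and every centre `‖x₀‖ ≤ ρ√(−t)`, some
point of `B(x₀, r√(−t))` has vorticity unsteadiness `‖(−t) • curl Φₜ‖ > δ(C,K,ρ,r)` — the
unsteadiness `∂ₛU` of the similarity profile is nowhere a gradient up to a `δ`-small curl. -/
theorem vorticityFlicker_floor_of_singular (C K ρ r : ℝ) (hr : 0 < r) : ∃ δ > 0,
    ∀ (w : ℝ → EuclideanSpace ℝ (Fin 3) → EuclideanSpace ℝ (Fin 3)),
      IsTypeIAncientMild C w →
      (∀ s : ℝ, s < 0 → ∫⁻ x, ‖fderiv ℝ (w s) x‖ₑ ^ 2 ≤ ENNReal.ofReal (K / Real.sqrt (-s))) →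
      (∀ r > 0, ∀ M : ℝ, ∃ t ∈ Set.Ioo (-(r ^ 2)) (0 : ℝ),
        ∃ x ∈ Metric.ball (0 : EuclideanSpace ℝ (Fin 3)) r, M < ‖w t x‖) →
      ∀ t < 0, ∀ x₀ : EuclideanSpace ℝ (Fin 3), ‖x₀‖ ≤ ρ * Real.sqrt (-t) →
        ∃ x ∈ ball x₀ (r * Real.sqrt (-t)),
          δ < ‖(-t) • curl (fun x => (-t) • deriv (fun τ => w τ x) t - (1 / 2 : ℝ) • w t x -
            (1 / 2 : ℝ) • fderiv ℝ (w t) x x) x‖ := by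
  obtain ⟨δ, hδ, h⟩ := vorticityCalm_leaf C K ρ r hr
  refine ⟨δ, hδ, fun w hw hlaw hsing t ht x₀ hx₀ => ?_⟩
  by_contra hnot
  push Not at hnot
  exact h w hw hlaw t ht x₀ hx₀ hnot hsing

end Summit.NavierStokesRegularity.NavierStokesRegularity.Theorems.FiniteDissipationLiouville.CalmSliceLocal

end
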